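import Summits.AnomalousDissipation.AnomalousDissipation.Theses.OsgoodStrain

/-!
# Glue of the WallExport split of `OsgoodStrain.OsgoodRoughStrainRougheningTG`

Sorry-free proof of the GLUE item `OsgoodStrain.OsgoodRoughWallExportGlue3TG` (stmt-AnomalousDissipation-31999):
`FatSkeletonRougheningTG → ConfinedExportRougheningTG → WallExportFatteningCoreTG → OsgoodRoughStrainRougheningTG` —
pure logic: excluded middle on `SkeletonWallExportTG`; with wall export the fattening core gives `SkeletonFatStrainTG` and the
fat-skeleton branch concludes, without it the confined-export branch concludes.  No facts are asserted.
Source: decomp-ad cell, lens-2 g8 node «WallExport» (kernel `run/shared/lean/pub/decomp-ad/decomp-ad-lens-2/WallExport.lean`,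
theorems `osgoodRough_of_wallPieces` / `glue3_holds`); landed by the cell's prover seat.
-/

set_option linter.dupNamespace false

namespace Summit.AnomalousDissipation.AnomalousDissipation.Theorems.OsgoodRoughWallExportGlue3TG

open Summit.AnomalousDissipation.AnomalousDissipation.Theses.OsgoodStrain

/-- The GLUE item `OsgoodStrain.OsgoodRoughWallExportGlue3TG` (stmt-AnomalousDissipation-31999) holds: case split on
`SkeletonWallExportTG`. [folklore] -/
theorem osgoodRoughWallExportGlue3TG_holds : OsgoodRoughWallExportGlue3TG := by
  intro hFat hConf hCore hS hV hL hnO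
  by_cases hW : SkeletonWallExportTG
  · exact hFat hS hV hL hnO (hCore hV hW)
  · exact hConf hS hV hL hnO hW

/-- EXACTNESS of the WallExport cut modulo the fattening core: given `WallExportFatteningCoreTG`,
`OsgoodRoughStrainRougheningTG ↔ FatSkeletonRougheningTG ∧ ConfinedExportRougheningTG` (both pieces are weakenings of the
parent by an extra hypothesis). [folklore] -/
theorem osgoodRoughStrainRougheningTG_iff_wallPieces (hCore : WallExportFatteningCoreTG) :
    OsgoodRoughStrainRougheningTG ↔ (FatSkeletonRougheningTG ∧ ConfinedExportRougheningTG) :=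
  ⟨fun h => ⟨fun hS hV hL hnO _ => h hS hV hL hnO, fun hS hV hL hnO _ => h hS hV hL hnO⟩,
   fun h => osgoodRoughWallExportGlue3TG_holds h.1 h.2 hCore⟩

end Summit.AnomalousDissipation.AnomalousDissipation.Theorems.OsgoodRoughWallExportGlue3TG
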